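import Literature.Analysis.FluidPDE.LagrangianDictionary
import Literature.Analysis.FluidPDE.BiotSavartC1Holder
import HarnessLib

/-!
# Prop. 4.2, first half: `F` is bounded on `O_M`, and the bound (4.40) for `G₁(X)Y`

Analysis/FluidPDE proofs file (no definitions, no named facts) on the discharge path of the
named fact `Literature.Analysis.FluidPDE.MajdaBertozzi2002_lagrangianField_lipschitzOn`
(Majda–Bertozzi, *Vorticity and Incompressible Flow*, CUP 2002, §4.1.3 **Prop. 4.2**, p. 128 of
the held text: "`F` is bounded and locally Lipschitz continuous on `O_M`"). The printed proof of
the boundedness (p. 129–130) is: change variables, `F(X) = K₃f ∘ X` with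
`f = (∇_αX ω₀) ∘ X⁻¹ det ∇ₓX⁻¹` ((4.37)); `|K₃f|_{1,γ} ≤ c‖f‖_γ` by the potential-theory
Lemmas 4.5–4.6 ((4.38)–(4.39)); `‖f‖_γ ≤ c(M)‖ω₀‖_γ` by the calculus inequalities (4.17),
(4.19), (4.22); and the composition with `X` by (4.20)–(4.21). The same argument with `∇_αY`
in place of `∇_αX` in the density bounds the first part
`G₁(X)Y = ∫ K₃[X(α) − X(α')] ∇_αY(α') ω₀(α') dα'` of the derivative `F'(X)Y` ((4.40), p. 130:
"`|G₁(X)Y|_{1,γ} ≤ c‖∇_αY‖_γ‖ω₀‖_γ(1 + c|X|_{1,γ}^{γ(2N−1)}) ≤ c(M)‖ω₀‖_γ|Y|_{1,γ}`").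

Everything printed is in the tree: (4.38)–(4.39) is `exists_biotSavart_c1Holder_bounds`
(`BiotSavartC1Holder.lean`), the change of variables and the density bounds, uniform over
`O_M` and linear in `|Y|_{1,γ}`, are `lagrangianOp_eq_biotSavart_comp`,
`norm_lagrangianPushforward_le`, `tsupport_lagrangianPushforward_subset`,
`holderWith_lagrangianPushforward` (`LagrangianDictionary.lean`). This file proves:

* `C1HolderMap.exists_comp_norm_le` — **(4.20)–(4.21) for `B`**: a bounded `C^{1,γ}` map `u`
  composed with `Y ∈ B` is in `B`, `‖u ∘ Y‖ ≤ |u|₀ + 2M₁|Y| + [∇u]_γ |Y|^{1+γ}`;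
* `exists_lagrangianOp_norm_le` — **the operator bound, uniform on `O_M`**: for `0 < γ < 1`,
  a compactly supported `γ`-Hölder `ω₀` and `M > 0` there is `c` with: for all `X ∈ O_M` and
  `Y ∈ B`, `T(X; Y, ω₀) = ∫ K₃(X α − X α') ∇Y(α') ω₀(α') dα'` is (the coercion of) an element
  of `B` of norm `≤ c |Y|_{1,γ}` — this is (4.40) for `G₁(X)Y = T(X; Y, ω₀)`, and for `Y = X`
  the boundedness `|F(X)|_{1,γ} ≤ c M` of `F(X) = T(X; X, ω₀)` (`exists_lagrangianField_norm_le`).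

The second half of Prop. 4.2 (the bound (4.41) for `G₂(X)Y`, Lemma 4.10, and the mean-value
assembly) is downstream.

## References

* A. J. Majda, A. L. Bertozzi, *Vorticity and Incompressible Flow* (CUP 2002), §4.1.3
  Prop. 4.2 and its proof, (4.37)–(4.40) (p. 128–130); Lemmas 4.1–4.3 (p. 126–127).
  [MajdaBertozziCUP2002]
-/

noncomputable section

open MeasureTheory Set Function Filter Metric
open _root_.Topology
open scoped NNReal

/-! ### Composition of a bounded `C^{1,γ}` map with a member of `B` -/

namespace Literature.Analysis.FunctionSpaces.C1HolderMap

variable {E F G : Type*} [NormedAddCommGroup E] [NormedSpace ℝ E] [NormedAddCommGroup F]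
  [NormedSpace ℝ F] [NormedAddCommGroup G] [NormedSpace ℝ G] {r : ℝ≥0}

/-- `‖∇Y a − ∇Y b‖ ≤ ‖Y‖ ‖a − b‖^r` for `Y ∈ B`. [folklore] -/
theorem norm_fderiv_sub_fderiv_le_norm (Y : C1HolderMap E F r) (a b : E) :
    ‖fderiv ℝ (Y : E → F) a - fderiv ℝ (Y : E → F) b‖ ≤ ‖Y‖ * ‖a - b‖ ^ (r : ℝ) := by
  have h := (Y.memBoundedHolder.memHolder.holderWith).dist_le a b
  rw [dist_eq_norm, dist_eq_norm] at h
  refine h.trans (mul_le_mul_of_nonneg_right ?_ (by positivity))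
  have h2 := Y.fderivBHF.nnHolderNorm_le_norm
  rw [coe_fderivBHF] at h2
  exact h2.trans Y.norm_fderivBHF_le

/-- **Majda–Bertozzi (4.20)–(4.21) in `B`: composition of a bounded `C^{1,r}` map with a member
of `B`.** If `u : F → G` is `C¹` with `‖u‖ ≤ a₀`, `‖∇u‖ ≤ M₁` and `∇u` `r`-Hölder with
constant `C`, and `Y ∈ B = C1HolderMap E F r`, then `u ∘ Y ∈ B` with
`‖u ∘ Y‖ ≤ a₀ + M₁‖Y‖ + (C ‖Y‖^r ‖Y‖ + M₁ ‖Y‖)`: `∇(u ∘ Y) = (∇u ∘ Y) ∇Y` is bounded by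
`M₁ ‖Y‖` and `r`-Hölder with constant `C ‖Y‖^r ‖Y‖ + M₁ ‖Y‖` ((4.16) and (4.20)). [cite: MajdaBertozziCUP2002, §4.1.1 Lemma 4.3 (4.20)–(4.21) (p. 127)] -/
theorem exists_comp_norm_le {u : F → G} (hu : ContDiff ℝ 1 u) {a₀ M₁ : ℝ} {C : ℝ≥0}
    (h0 : ∀ x, ‖u x‖ ≤ a₀) (hM₁ : 0 ≤ M₁) (h1 : ∀ x, ‖fderiv ℝ u x‖ ≤ M₁)
    (h2 : HolderWith C r (fderiv ℝ u)) (Y : C1HolderMap E F r) :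
    ∃ V : C1HolderMap E G r, (V : E → G) = u ∘ (Y : E → F) ∧
      ‖V‖ ≤ a₀ + M₁ * ‖Y‖ + (C * ‖Y‖ ^ (r : ℝ) * ‖Y‖ + M₁ * ‖Y‖) := by
  have hY0 : 0 ≤ ‖Y‖ := norm_nonneg _
  have hderiv : ∀ a, HasFDerivAt (u ∘ (Y : E → F))
      ((fderiv ℝ u (Y a)).comp (fderiv ℝ (Y : E → F) a)) a := fun a =>
    ((hu.differentiable one_ne_zero) (Y a)).hasFDerivAt.comp a (Y.differentiable a).hasFDerivAt
  have hfd : fderiv ℝ (u ∘ (Y : E → F)) = fun a => (fderiv ℝ u (Y a)).comp (fderiv ℝ (Y : E → F) a) :=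
    funext fun a => (hderiv a).fderiv
  -- sup bound of the derivative
  have hsup : ∀ a, ‖fderiv ℝ (u ∘ (Y : E → F)) a‖ ≤ M₁ * ‖Y‖ := fun a => by
    rw [hfd]
    exact (ContinuousLinearMap.opNorm_comp_le _ _).trans
      (mul_le_mul (h1 _) (Y.norm_fderiv_le a) (norm_nonneg _) hM₁)
  -- Hölder bound of the derivative
  have hL0 : 0 ≤ C * ‖Y‖ ^ (r : ℝ) * ‖Y‖ + M₁ * ‖Y‖ := by positivity
  have hhol : HolderWith (Real.toNNReal (C * ‖Y‖ ^ (r : ℝ) * ‖Y‖ + M₁ * ‖Y‖)) r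
      (fderiv ℝ (u ∘ (Y : E → F))) := by
    refine holderWith_of_dist_le fun a b => ?_
    rw [dist_eq_norm, dist_eq_norm, Real.coe_toNNReal _ hL0, hfd]
    have hsplit : (fderiv ℝ u (Y a)).comp (fderiv ℝ (Y : E → F) a) -
        (fderiv ℝ u (Y b)).comp (fderiv ℝ (Y : E → F) b) =
        (fderiv ℝ u (Y a) - fderiv ℝ u (Y b)).comp (fderiv ℝ (Y : E → F) a) +
          (fderiv ℝ u (Y b)).comp (fderiv ℝ (Y : E → F) a - fderiv ℝ (Y : E → F) b) := by
      rw [ContinuousLinearMap.sub_comp, ContinuousLinearMap.comp_sub]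
      abel
    rw [hsplit]
    have hu' : ‖fderiv ℝ u (Y a) - fderiv ℝ u (Y b)‖ ≤ C * (‖Y‖ * ‖a - b‖) ^ (r : ℝ) := by
      have h := h2.dist_le (Y a) (Y b)
      rw [dist_eq_norm, dist_eq_norm] at h
      refine h.trans ?_
      gcongr
      exact Y.norm_sub_apply_le a b
    have e1 : ‖(fderiv ℝ u (Y a) - fderiv ℝ u (Y b)).comp (fderiv ℝ (Y : E → F) a)‖ ≤
        C * (‖Y‖ * ‖a - b‖) ^ (r : ℝ) * ‖Y‖ :=
      (ContinuousLinearMap.opNorm_comp_le _ _).trans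
        (mul_le_mul hu' (Y.norm_fderiv_le a) (norm_nonneg _) (by positivity))
    have e2 : ‖(fderiv ℝ u (Y b)).comp (fderiv ℝ (Y : E → F) a - fderiv ℝ (Y : E → F) b)‖ ≤
        M₁ * (‖Y‖ * ‖a - b‖ ^ (r : ℝ)) :=
      (ContinuousLinearMap.opNorm_comp_le _ _).trans
        (mul_le_mul (h1 _) (Y.norm_fderiv_sub_fderiv_le_norm a b) (norm_nonneg _) hM₁)
    calc ‖(fderiv ℝ u (Y a) - fderiv ℝ u (Y b)).comp (fderiv ℝ (Y : E → F) a) +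
            (fderiv ℝ u (Y b)).comp (fderiv ℝ (Y : E → F) a - fderiv ℝ (Y : E → F) b)‖
        ≤ C * (‖Y‖ * ‖a - b‖) ^ (r : ℝ) * ‖Y‖ + M₁ * (‖Y‖ * ‖a - b‖ ^ (r : ℝ)) :=
          (norm_add_le _ _).trans (add_le_add e1 e2)
      _ = (C * ‖Y‖ ^ (r : ℝ) * ‖Y‖ + M₁ * ‖Y‖) * ‖a - b‖ ^ (r : ℝ) := by
          rw [Real.mul_rpow hY0 (norm_nonneg _)]
          ring
  have hmem : MemBoundedHolder r (fderiv ℝ (u ∘ (Y : E → F))) :=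
    memBoundedHolder_iff.2 ⟨⟨_, hsup⟩, hhol.memHolder⟩
  refine ⟨⟨u ∘ (Y : E → F), hu.comp Y.contDiff, hmem⟩, rfl, ?_⟩
  have h := norm_le_of_bounds (⟨u ∘ (Y : E → F), hu.comp Y.contDiff, hmem⟩ : C1HolderMap E G r)
    (a := a₀) (M₁ := M₁ * ‖Y‖) (C := Real.toNNReal (C * ‖Y‖ ^ (r : ℝ) * ‖Y‖ + M₁ * ‖Y‖))
    (h0 _) (by positivity) hsup hhol
  rwa [Real.coe_toNNReal _ hL0] at h

end Literature.Analysis.FunctionSpaces.C1HolderMap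

namespace Literature.Analysis.FluidPDE

open FunctionSpaces

/-- Local notation for physical space `ℝ³ = EuclideanSpace ℝ (Fin 3)`. -/
local notation "ℝ³" => EuclideanSpace ℝ (Fin 3)

/-! ### The operator bound on `O_M` -/

section Bound

variable {γ : ℝ≥0} (hγ : 0 < γ) (hγ1 : γ < 1)
include hγ hγ1

/-- **The bound (4.40) / the boundedness of `F`, uniform on `O_M`.** For `0 < γ < 1`, a
`γ`-Hölder density `ω₀` with constant `C_ω`, supported in `B̄(x₀, R)` and bounded by `M_ω`, and
`M > 0`, there is `c ≥ 0` such that for every `X ∈ O_M` and every `Y ∈ B` the Lagrangian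
operator `T(X; Y, ω₀)(α) = ∫ K₃(X α − X α') ∇Y(α') ω₀(α') dα'` (`lagrangianOp ω₀ X Y`) is the
coercion of an element of `B` of norm `≤ c |Y|_{1,γ}`. Proof as printed (p. 129–130):
`T(X; Y, ω₀) = K₃f ∘ X` with `f` the pushed-forward density of `(X, Y, ω₀)`, supported in
`B̄(X x₀, MR)`, bounded by `2|Y| M_ω`, `γ`-Hölder with constant `|Y| · c(M)` ; then
(4.38)–(4.39) (`exists_biotSavart_c1Holder_bounds`) and the composition estimate
`C1HolderMap.exists_comp_norm_le` with `|X|_{1,γ} < M`. [cite: MajdaBertozziCUP2002, §4.1.3 proof of Prop. 4.2, (4.37)–(4.40) (p. 129–130)] -/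
theorem exists_lagrangianOp_norm_le {ω₀ : ℝ³ → ℝ³} {Cω : ℝ≥0} {x₀ : ℝ³} {R Mω : ℝ} (hR : 0 < R)
    (hω : HolderWith Cω γ ω₀) (hsupp : tsupport ω₀ ⊆ closedBall x₀ R) (hMω : ∀ a, ‖ω₀ a‖ ≤ Mω)
    {M : ℝ} (hM : 0 < M) :
    ∃ c : ℝ, 0 ≤ c ∧ ∀ (X : C1HolderMap ℝ³ ℝ³ γ), X ∈ trajectoryOpenSet γ M →
      ∀ Y : C1HolderMap ℝ³ ℝ³ γ, ∃ V : C1HolderMap ℝ³ ℝ³ γ,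
        (V : ℝ³ → ℝ³) = lagrangianOp ω₀ (X : ℝ³ → ℝ³) (Y : ℝ³ → ℝ³) ∧ ‖V‖ ≤ c * ‖Y‖ := by
  have hγ1' : γ ≤ 1 := by exact_mod_cast hγ1.le
  obtain ⟨c₀, hc₀, hK⟩ := exists_biotSavart_c1Holder_bounds hγ hγ1
  have hMω0 : 0 ≤ Mω := (norm_nonneg _).trans (hMω x₀)
  have hK0 := inverseBound_nonneg M
  -- the constants, per unit `‖Y‖`
  set P : ℝ := pushforwardHolderConst γ M Cω Mω with hP
  have hP0 : 0 ≤ P := pushforwardHolderConst_nonneg hM.le Cω.coe_nonneg hMω0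
  set R' : ℝ := M * R with hR'
  have hR'0 : 0 < R' := mul_pos hM hR
  set a₁ : ℝ := 5 * (2 * Mω) * R' with ha₁
  set m₁ : ℝ := c₀ * (P * R' ^ (γ : ℝ) + 2 * Mω) with hm₁
  set h₁ : ℝ := c₀ * (P + 2 * Mω * (R' ^ (γ : ℝ))⁻¹) with hh₁
  have ha₁0 : 0 ≤ a₁ := by positivity
  have hm₁0 : 0 ≤ m₁ := by positivity
  have hh₁0 : 0 ≤ h₁ := by positivity
  refine ⟨a₁ + m₁ * M + (h₁ * M ^ (γ : ℝ) * M + m₁ * M), by positivity, fun X hX Y => ?_⟩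
  have hXM : ‖X‖ ≤ M := (norm_lt_of_mem_trajectoryOpenSet hX).le
  have hY0 : 0 ≤ ‖Y‖ := norm_nonneg _
  -- the pushed-forward density and its bounds
  set f : ℝ³ → ℝ³ := lagrangianPushforward (X : ℝ³ → ℝ³) (Y : ℝ³ → ℝ³) ω₀ with hf
  have hfH : HolderWith (Real.toNNReal (‖Y‖ * P)) γ f :=
    holderWith_lagrangianPushforward hγ hγ1' hX Y hω hMω
  have hfsupp : tsupport f ⊆ closedBall (X x₀) R' :=
    tsupport_lagrangianPushforward_subset hγ hγ1' hX Y hsupp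
  have hfM : ∀ x, ‖f x‖ ≤ 2 * ‖Y‖ * Mω := norm_lagrangianPushforward_le hX Y hMω
  obtain ⟨hmem, hb0, hb1, hb2, -⟩ := hK f _ (X x₀) R' (2 * ‖Y‖ * Mω) hR'0 hfH hfsupp hfM
  rw [Real.coe_toNNReal _ (mul_nonneg hY0 hP0)] at hb1 hb2
  -- rewrite the three bounds as multiples of `‖Y‖`
  have hb0' : ∀ x, ‖biotSavart f x‖ ≤ a₁ * ‖Y‖ := fun x => (hb0 x).trans_eq (by rw [ha₁]; ring)
  have hb1' : ∀ x, ‖fderiv ℝ (biotSavart f) x‖ ≤ m₁ * ‖Y‖ := fun x =>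
    (hb1 x).trans_eq (by rw [hm₁]; ring)
  have hcoef : c₀ * (‖Y‖ * P + 2 * ‖Y‖ * Mω * (R' ^ (γ : ℝ))⁻¹) = h₁ * ‖Y‖ := by
    rw [hh₁]; ring
  rw [hcoef] at hb2
  -- compose with `X`
  obtain ⟨V, hV, hVn⟩ := C1HolderMap.exists_comp_norm_le hmem.contDiff hb0'
    (by positivity) hb1' hb2 X
  refine ⟨V, ?_, hVn.trans ?_⟩
  · rw [hV, hf, lagrangianOp_eq_biotSavart_comp hγ hγ1' hX Y ω₀]
  · have hMγ : ‖X‖ ^ (γ : ℝ) ≤ M ^ (γ : ℝ) := Real.rpow_le_rpow (norm_nonneg _) hXM (by positivity)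
    have hh₁Y : 0 ≤ h₁ * ‖Y‖ := by positivity
    rw [Real.coe_toNNReal _ hh₁Y]
    calc a₁ * ‖Y‖ + m₁ * ‖Y‖ * ‖X‖ + (h₁ * ‖Y‖ * ‖X‖ ^ (γ : ℝ) * ‖X‖ + m₁ * ‖Y‖ * ‖X‖)
        ≤ a₁ * ‖Y‖ + m₁ * ‖Y‖ * M + (h₁ * ‖Y‖ * M ^ (γ : ℝ) * M + m₁ * ‖Y‖ * M) := by
          gcongr
      _ = (a₁ + m₁ * M + (h₁ * M ^ (γ : ℝ) * M + m₁ * M)) * ‖Y‖ := by ring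

/-- **`F` is bounded on `O_M`** (Prop. 4.2, first assertion, p. 128–130: "the operator
`F : O_M → B` is bounded", `|F(X)|_{1,γ} ≤ c|K₃f|_{1,γ}|X|²_{1,γ}`, `|K₃f|_{1,γ} ≤ c(M)‖ω₀‖_γ`):
with the constant `c` of `exists_lagrangianOp_norm_le`, every `F(X) = T(X; X, ω₀)`, `X ∈ O_M`,
is the coercion of an element of `B` of norm `≤ c M`. [cite: MajdaBertozziCUP2002, §4.1.3 Prop. 4.2 (p. 128) and its proof (p. 129–130)] -/
theorem exists_lagrangianField_norm_le {ω₀ : ℝ³ → ℝ³} {Cω : ℝ≥0} {x₀ : ℝ³} {R Mω : ℝ} (hR : 0 < R)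
    (hω : HolderWith Cω γ ω₀) (hsupp : tsupport ω₀ ⊆ closedBall x₀ R) (hMω : ∀ a, ‖ω₀ a‖ ≤ Mω)
    {M : ℝ} (hM : 0 < M) :
    ∃ C : ℝ, 0 ≤ C ∧ ∀ (X : C1HolderMap ℝ³ ℝ³ γ), X ∈ trajectoryOpenSet γ M →
      ∃ V : C1HolderMap ℝ³ ℝ³ γ, (V : ℝ³ → ℝ³) = lagrangianField ω₀ (X : ℝ³ → ℝ³) ∧ ‖V‖ ≤ C := by
  obtain ⟨c, hc, h⟩ := exists_lagrangianOp_norm_le hγ hγ1 hR hω hsupp hMω hM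
  refine ⟨c * M, by positivity, fun X hX => ?_⟩
  obtain ⟨V, hV, hVn⟩ := h X hX X
  refine ⟨V, by rw [hV, lagrangianField_eq_lagrangianOp], hVn.trans ?_⟩
  exact mul_le_mul_of_nonneg_left (norm_lt_of_mem_trajectoryOpenSet hX).le hc

omit hγ1 in
/-- **The data of Thm 4.2 fit**: a compactly supported `γ`-Hölder `ω₀` (`MemHolder`, the
printed `|ω₀|_γ < ∞`) admits a Hölder constant, a support ball of positive radius and a sup
bound, so the two theorems above apply to it. [folklore] -/
theorem exists_data_of_memHolder {ω₀ : ℝ³ → ℝ³} (hω : MemHolder γ ω₀) (hωc : HasCompactSupport ω₀) :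
    ∃ (Cω : ℝ≥0) (R Mω : ℝ), 0 < R ∧ HolderWith Cω γ ω₀ ∧ tsupport ω₀ ⊆ closedBall 0 R ∧
      ∀ a, ‖ω₀ a‖ ≤ Mω := by
  obtain ⟨Cω, hCω⟩ := hω
  obtain ⟨R₀, hR₀⟩ := hωc.isCompact.isBounded.subset_closedBall (0 : ℝ³)
  obtain ⟨Mω, hMω⟩ := (hCω.continuous hγ).bounded_above_of_compact_support hωc
  exact ⟨Cω, max R₀ 1, Mω, lt_max_of_lt_right one_pos, hCω,
    hR₀.trans (closedBall_subset_closedBall (le_max_left _ _)), hMω⟩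

end Bound

end Literature.Analysis.FluidPDE
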